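import Literature.Analysis.FluidPDE.NSCriticalClosureBounded
import Literature.Analysis.FluidPDE.KNSSTypeIIHolds
import HarnessLib

/-!
# The critical Besov continuation criterion along the Escauriaza–Seregin–Šverák line
# (Wang–Zhang 2017): reduction to boundedness near the final time

Analysis/FluidPDE assembly file (proofs only: no definitions, no named facts, no statement of the
tree is changed) for the named fact
`Literature.Analysis.FluidPDE.hasSmoothExtensionPast_of_eHomBesovNorm_bounded`
(`NSCriticalClosure.lean`: a classical solution of the unforced Navier–Stokes system on
`ℝ³ × [0, T)`, Leray–Hopf from a rapidly decaying datum, whose critical Besov norm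
`‖U t‖_{Ḃ^{-1+3/r}_{r,q}}`, `3 < r, q < ∞`, is bounded on `[0, T)`, extends as a classical
solution past `T`; vendored after Gallagher–Koch–Planchon 2016, Thm. 1).

## Why this file exists: a second published line, for classical solutions

`NSCriticalClosureBesovSingleLeaf.lean` records the fact as the consequence of ONE remaining
named fact of blow-up-criterion type for the abstract *Besov mild* class — GKP 2016, Thm. 1
(`gkp_besov_blowup`; profile decompositions), equivalently GKP Props. 2.1–2.3, or Albritton 2018,
Thm. 1.1 (`albritton_besov_blowup`; Calderón solutions) — everything else being proved, and
remarks that no chain avoiding such a criterion is known. For the **classical Leray–Hopf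
solutions the fact is actually about**, there is one in print:

* W. Wang, Z. Zhang, *Blow-up of critical norms for the 3-D Navier–Stokes equations*, Sci. China
  Math. 60 (2017) 637–650 = arXiv:1510.02589, **Thm. 1.1**: "Let `(u, π)` be a smooth solution of
  (NS) in `ℝ³ × [0, T)`. If `‖u₃‖_{L^∞(0,T; Ḃ^{-1+3/p}_{p,q})} + ‖u_h‖_{L^∞(0,T; BMO⁻¹)} = M < ∞`
  for some `3 < p, q < ∞` and `u_h(x, T) ∈ VMO⁻¹(ℝ³)`, then `u` can be extended after `t = T`."
  Under the hypothesis of our fact all three components are bounded in `Ḃ^{-1+3/r}_{r,q}`, which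
  embeds in `VMO⁻¹ ⊂ BMO⁻¹` (ibid. Lemma 3.1), so Thm. 1.1 applies with `u₃`'s hypothesis holding
  for every component; in that case the paper's one-component interior criteria (Thms. 1.3, 1.4,
  Prop. 6.1) are not needed and the classical ε-regularity (ibid. Prop. 2.2 = CKN; Prop. 2.3 =
  Gustafson–Kang–Tsai) suffices in §4.

  The printed proof (§4, "Proof of Theorem 1.1": "Following [ESS], the proof is based on blow-up
  analysis and backward uniqueness of parabolic equations. It suffices to prove that
  `u ∈ L^∞(ℝ³ × (-1, 0))`") uses NO profile decomposition and NO mild/Calderón solution theory: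
  - Lemma 4.1 (local scale-invariant energy bounds `A + E + D ≤ C(M, C(u,½,z₀), D(π,½,z₀))`
    for `z₀ ∈ ℝ³ × (-¼, 0)`, `0 < r < ½`, from `u = ∇·U`, `U ∈ L^∞_t BMO_x` (Koch–Tataru's
    divergence form of `BMO⁻¹` — the tree's `FunctionSpaces.MemBMOInv`; the embedding
    `Ḃ^{-1+3/p}_{p,∞} ⊂ BMO⁻¹` is the tree's PROVED `memBMOInv_of_memHomBesov_holds`), the
    John–Nirenberg `L^q` bounds of `U - U_B` (tree: `FunctionSpaces.john_nirenberg_holds`), the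
    local energy inequality, the pressure decomposition Lemma 2.4 (Wang–Zhang, J. Anal. Math.
    123 (2014)) and a standard iteration (cf. the tree's `CKNMorreyIteration.lean`);
  - Step 1 (blow-up at a singular point `(0,0)`: CKN ε-regularity gives concentration
    `r_k⁻² ∫_{Q_{r_k}} |u|³ ≥ ε³`; rescale `u^k = r_k u(r_k x, r_k² t)`; Aubin–Lions limit `v`,
    suitable, with the bounds of Lemma 4.1 and `‖v(t)‖_{Ḃ} ≤ M`; spatial decay
    `∫_{Q₁(z₀)} |v|³ → 0`, `|z₀| → ∞`, from the density of `C_c^∞` in `Ḃ^{-1+3/p}_{p,q}`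
    (`p, q < ∞`) and the interpolation Lemma 3.2
    `‖u‖_{L²(B₁(x₀))} ≤ C ‖u‖_{Ḃ^{-1+3/p}_{p,∞}}^θ ‖u‖_{H¹(B₂(x₀))}^{1-θ}`, `θ = p/(2p-3)`; hence
    `v` regular outside a ball, `|v| + |∇v| ≤ C` on `(ℝ³ ∖ B_R) × (-T, 0)`);
  - Step 2 (`v(x, 0) = 0`, from `u(·, T) ∈ VMO⁻¹`: the rescaled `BMO` averages of the
    representing field at the final time vanish — for Besov data this is the vanishing of the
    critical rescalings `λ f(λ ·) ⇀ 0`, `λ → 0`, of an element of `Ḃ^{-1+3/p}_{p,q}`, `q < ∞`);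
  - Step 3 (backward uniqueness and unique continuation for `w = ∇ × v`,
    `|∂ₜ w - Δ w| ≤ C(|w| + |∇w|)` outside `B_R`, `w(·, 0) = 0` ⟹ `w ≡ 0` ⟹ `v ≡ 0`,
    contradicting the concentration) — the engine of Escauriaza–Seregin–Šverák 2003, §§3–5,
    which the tree is discharging for the `L³` sibling fact
    `hasSmoothExtensionPast_of_eLpNorm_three_bounded` (`ess_unique_continuation_holds`,
    `ess_backward_uniqueness_C1`, CKN ε-regularity `…Holds` files, `ESSLocalHolder*.lean`).

This file records the endpoint of that line in the tree's vocabulary, exactly as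
`hasSmoothExtensionPast_of_eLpNorm_three_bounded_of_ess_bounded` (`NSCriticalClosureBounded.lean`)
does for the `L³` criterion with ESS (3.5)–(3.6) (`ess_sup_bound`):

* `hasSmoothExtensionPast_of_eHomBesovNorm_bounded_of_besov_sup_bound` — the fact follows from
  **boundedness away from the initial time** of classical Leray–Hopf solutions with bounded
  critical Besov norm (the conclusion "`u ∈ L^∞(ℝ³ × (-1, 0))`" of Wang–Zhang's proof of Thm. 1.1,
  stated for every initial layer `δ > 0`, hypothesis `hWZ`, kept explicit — it is NOT asserted),
  by the continuation of bounded classical Leray–Hopf solutions `hasSmoothExtensionPast_of_bounded`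
  (Robinson–Rodrigo–Sadowski 2016, Thm. 8.17 with Thms. 6.15, 6.10 — PROVED,
  `hasSmoothExtensionPast_of_bounded_holds`, `KNSSTypeIIHolds.lean`): restart at an energy-good
  time `s`, continue the bounded translate past `T - s`, glue back
  (`HasSmoothExtensionPast.of_translate`). The rapid decay of the datum and the distributions
  `U t` enter only through `hWZ`.

So a discharge of the Wang–Zhang boundedness statement `hWZ` — Lemma 4.1 plus the ESS engine —
discharges `hasSmoothExtensionPast_of_eHomBesovNorm_bounded` by this one theorem, independently of
GKP's Thm. 1 and of Albritton's Thm. 1.1.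

## Mathlib / tree search

Tree (`lean search`, 2026-08-15): `hasSmoothExtensionPast_of_bounded_holds` (`KNSSTypeIIHolds`),
`IsLerayHopfOn.exists_isLerayHopfOn_translate` (`LerayHopfTranslate`),
`IsClassicalNSSolutionOn.translate_Ico_zero`, `HasSmoothExtensionPast.of_translate`
(`ClassicalSolutionGlue`); the `L³` template `hasSmoothExtensionPast_of_eLpNorm_three_bounded_of_ess_bounded`
(`NSCriticalClosureBounded`); `memBMOInv_of_memHomBesov_holds` (`CriticalSpacesBMOInvProofs`),
`FunctionSpaces.john_nirenberg_holds` (`BMOJohnNirenberg`). No Wang–Zhang statement was in the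
tree (`lean search 'WangZhang|wangZhang'`: no hits). Mathlib: no Navier–Stokes theory.

## References

* W. Wang, Z. Zhang, *Blow-up of critical norms for the 3-D Navier–Stokes equations*, Sci. China
  Math. 60 (2017) 637–650, doi:10.1007/s11425-016-0344-5 = arXiv:1510.02589: Thm. 1.1, Lemmas
  3.1, 3.2, 4.1, §4 "Proof of Theorem 1.1" Steps 1–3, Props. 2.2–2.3. [WangZhang2016]
* L. Escauriaza, G. Seregin, V. Šverák, *`L_{3,∞}`-solutions of Navier–Stokes equations and
  backward uniqueness*, Russ. Math. Surveys 58:2 (2003) 211–250, §3, Thms. 4.1, 5.1.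
  [EscauriazaSereginSverak2003]
* J. C. Robinson, J. L. Rodrigo, W. Sadowski, *The Three-Dimensional Navier–Stokes Equations*,
  CUP 2016, Thm. 8.17 with Thms. 6.15, 6.10. [RobinsonRodrigoSadowski2016]
* I. Gallagher, G. S. Koch, F. Planchon, Comm. Math. Phys. 343 (2016) 39–82, Thm. 1. [GKP2016]
* H. Koch, D. Tataru, Adv. Math. 157 (2001) 22–35, Thm. 1. [KochTataru2001]
-/

noncomputable section

open MeasureTheory Set Function Filter
open _root_.Topology
open scoped ENNReal NNReal

namespace Literature.Analysis.FluidPDE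

/-- **The critical Besov continuation criterion from boundedness near the final time**
(Wang–Zhang 2017, Thm. 1.1, whose proof (§4) establishes exactly "`u ∈ L^∞(ℝ³ × (-1, 0))`" for a
smooth solution with bounded critical norm, by Lemma 4.1 and the Escauriaza–Seregin–Šverák
blow-up / backward-uniqueness argument; second half: continuation of bounded classical
Leray–Hopf solutions, Robinson–Rodrigo–Sadowski 2016, Thm. 8.17, proved in the tree as
`hasSmoothExtensionPast_of_bounded_holds`). **Hypothesis `hWZ` (not asserted):** for `ν > 0`,
`T > 0`, `3 < r, q < ∞`, every classical solution of the unforced system on `ℝ³ × [0, T)` which is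
Leray–Hopf from `u 0`, with slices represented by tempered distributions `U t` and
`sup_{0 ≤ t < T} ‖U t‖_{Ḃ^{-1+3/r}_{r,q}} < ∞`, is bounded on `[δ, T) × ℝ³` for every `δ ∈ (0, T)`.
**Conclusion:** `hasSmoothExtensionPast_of_eHomBesovNorm_bounded`. Proof: restart at an
energy-good time `s ∈ (0, T)` (`IsLerayHopfOn.exists_isLerayHopfOn_translate`), where the
translate `u(· + s)` is classical on `[0, T - s)`, Leray–Hopf from `u s` and bounded (by `hWZ`
with `δ = s`); continue it past `T - s` by `hasSmoothExtensionPast_of_bounded_holds` and glue back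
(`HasSmoothExtensionPast.of_translate`). The rapid decay of the datum is not used.
[cite: WangZhang2016, Thm. 1.1 and §4] [cite: RobinsonRodrigoSadowski2016, Thm. 8.17] -/
theorem hasSmoothExtensionPast_of_eHomBesovNorm_bounded_of_besov_sup_bound
    (hWZ : ∀ ⦃ν T : ℝ⦄, 0 < ν → 0 < T →
      ∀ ⦃u : ℝ → EuclideanSpace ℝ (Fin 3) → EuclideanSpace ℝ (Fin 3)⦄
        ⦃p : ℝ → EuclideanSpace ℝ (Fin 3) → ℝ⦄
        ⦃U : ℝ → TemperedDistribution (EuclideanSpace ℝ (Fin 3)) (EuclideanSpace ℂ (Fin 3))⦄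
        ⦃r q : ℝ≥0∞⦄ [Fact (1 ≤ r)], 3 < r → r < ⊤ → 3 < q → q < ⊤ →
        IsClassicalNSSolutionOn (Ico 0 T) ν 0 u p → IsLerayHopfOn T ν 0 (u 0) u →
        (∀ t ∈ Ico 0 T, IsDistributionOf (u t) (U t)) →
        (⨆ t ∈ Ico 0 T, FunctionSpaces.eHomBesovNorm (-1 + 3 / r.toReal) r q (U t)) < ⊤ →
          ∀ δ ∈ Ioo 0 T, ∃ M : ℝ, ∀ t ∈ Ico δ T, ∀ x, ‖u t x‖ ≤ M) :
    hasSmoothExtensionPast_of_eHomBesovNorm_bounded := by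
  intro ν T hν hT u p U r q _ hr₃ hr hq₃ hq hsol hLH _h₀ hU hsup
  -- an energy-good restarting time `s ∈ (0, T)`
  obtain ⟨s, hs, hLHs⟩ := hLH.exists_isLerayHopfOn_translate hsol hν.le hT le_rfl
  -- the Wang–Zhang bound on `[s, T) × ℝ³`
  obtain ⟨M, hM⟩ := hWZ hν hT hr₃ hr hq₃ hq hsol hLH hU hsup s hs
  -- the translate: classical on `[0, T - s)`, Leray–Hopf from `u s`, bounded on `[0, T - s) × ℝ³`
  have hsol' : IsClassicalNSSolutionOn (Ico 0 (T - s)) ν 0 (fun t => u (t + s))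
      (fun t => p (t + s)) := hsol.translate_Ico_zero hs.1.le
  have hLHs' : IsLerayHopfOn (T - s) ν 0 ((fun t => u (t + s)) 0) (fun t => u (t + s)) := by
    show IsLerayHopfOn (T - s) ν 0 (u (0 + s)) (fun t => u (t + s))
    rw [zero_add]
    exact hLHs
  have hMs : ∃ M : ℝ, ∀ t ∈ Ico 0 (T - s), ∀ x, ‖(fun t => u (t + s)) t x‖ ≤ M :=
    ⟨M, fun t ht x => hM (t + s) ⟨by linarith [ht.1], by linarith [ht.2]⟩ x⟩
  -- continuation of the bounded translate past `T - s`, glued back to `u`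
  have hext : HasSmoothExtensionPast ν 0 (fun t => u (t + s)) (T - s) :=
    hasSmoothExtensionPast_of_bounded_holds hν (sub_pos.2 hs.2) hsol' hLHs' hMs
  exact HasSmoothExtensionPast.of_translate hsol hs.1 hs.2 hext

end Literature.Analysis.FluidPDE

end
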